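import Mathlib
import Summits.ValiantsHypothesis.ValiantsHypothesis.Theorems.BarrierLeverPartitionMinorsHitByVPHiddenStatesPathTableKOne
import Summits.ValiantsHypothesis.ValiantsHypothesis.Theorems.BarrierLeverPartitionMinorsHitByVPHiddenStatesSecondShellExchange
import Summits.ValiantsHypothesis.ValiantsHypothesis.Theorems.BarrierLeverPartitionMinorsHitByVPHiddenStatesSecondShellTrapped

/-!
# Route BarrierLever — item `PartitionMinorsHitByVP` (stmt-ValiantsHypothesis-19717), line `hidden-states`:
# ★★ SECOND-SHELL CELLS OF HALF-BALL BY EXCHANGE COMPOSITION — every class `B_t(2t+1) − {A₁,A₂} + {C₁,C₂}` with an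
# IMMOBILE TOKEN (`A₂ ∩ C₂ ⊄ A₁ ∪ C₁`), every `t`

Helper file (`--supports stmt-ValiantsHypothesis-19717`; cell valiant-natproofs, 𝒟-side door (c), registered line
`Cruxes/PartitionMinorsHitByVP/Lines/hidden_states.lean` v8; prover seat val-np-p6 gen 17).  Closes NO item.  Definitions: the
first-shell table of a swap transported to the ambient coordinates (`coreTable`, `swapTable`, transparent).

THE CELL (memo HOME/val-np-p6/g17/MEMO-valnp6-g17.md §1–2).  `U = B_t(2t+1) ∖ {A₁, A₂} ∪ {C₁, C₂}`, `|A_l| = t`, `|C_l| = t + 1`,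
`A_l ⊄ C_l`, `A₁ ≠ A₂`, `C₁ ≠ C₂`, and a coordinate `z ∈ A₂ ∩ C₂` outside `A₁ ∪ C₁`.  With `N_l` = g16's first-shell path table of the
swap `(A_l, C_l)` minus the identity and `T(ε) = I + ε₀N₁ + ε₁N₂`: `z` is a row of neither `N₁` (`z ∉ C₁`) nor `N₂` (`z ∈ A₂`), so
`{z}` is forward-closed for every `ε` — the token of `C₂` at `z` is TRAPPED outside `A₁` and the cross minor `D_{B − A₁ + C₂}(T(ε))`
vanishes identically (`…SecondShellTrapped`); the direct minors are the first-shell certificates at `ε = (1,0), (0,1)`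
(`swapTable_det_ne_zero`, g16's theorem with the transport exposed); `…SecondShellExchange` composes.  ★★ `exists_table_secondShell_CT`.
Census (memo §2): this one cell serves 360/390 second-shell families at `t = 2` and 190 995/214 515 at `t = 3`.

HONEST LABEL: cells of the GC½ conjecture column (second shell); 19717 stays OPEN; nothing on crux 14610 or VP ≠ VNP.
-/

set_option linter.dupNamespace false

namespace Summit.ValiantsHypothesis.ValiantsHypothesis.Theorems.BarrierLever.HiddenStates

open Finset

noncomputable section

namespace SecondShell

open PathTable

/-! ## The transported first-shell table of a swap -/

/-- the first-shell table on the abstract index type: path table `pw k 1` on the core `Fin (k+1) ⊕ Fin k`, identity on the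
`2j` inert coordinates, no cross sources. -/
def coreTable (k j : ℕ) : (Fin (k + 1) ⊕ Fin k) ⊕ (Fin j ⊕ Fin j) → (Fin (k + 1) ⊕ Fin k) ⊕ (Fin j ⊕ Fin j) → ℂ
  | Sum.inl a₁, Sum.inl q₁ => pw k 1 a₁ q₁
  | Sum.inl _, Sum.inr _ => 0
  | Sum.inr z, q => if q = Sum.inr z then 1 else 0

/-- the table transported along an equivalence `e` onto the ambient coordinates. -/
def swapTable {α : Type} {k j : ℕ} (e : (Fin (k + 1) ⊕ Fin k) ⊕ (Fin j ⊕ Fin j) ≃ α) : α → α → ℂ :=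
  fun a q => coreTable k j (e.symm a) (e.symm q)

variable {α : Type} [Fintype α] [DecidableEq α]

omit [Fintype α] [DecidableEq α] in
/-- diagonal entries of a swap table are `1`. -/
theorem swapTable_self {k j : ℕ} (e : (Fin (k + 1) ⊕ Fin k) ⊕ (Fin j ⊕ Fin j) ≃ α) (a : α) : swapTable e a a = 1 := by
  unfold swapTable
  rcases e.symm a with a₁ | z
  · simp [coreTable, pw_self]
  · simp [coreTable]

/-- the row of an X-element of the core is a unit vector. -/
theorem coreTable_inr_row (k j : ℕ) (i : Fin k) (q : (Fin (k + 1) ⊕ Fin k) ⊕ (Fin j ⊕ Fin j)) :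
    coreTable k j (Sum.inl (Sum.inr i)) q = if q = Sum.inl (Sum.inr i) then 1 else 0 := by
  rcases q with (b | i') | z
  · simp [coreTable, pw]
  · by_cases h : i' = i
    · subst h; simp [coreTable, pw]
    · simp [coreTable, pw, h]
  · simp [coreTable]

/-- the row of an inert coordinate is a unit vector. -/
theorem coreTable_inert_row (k j : ℕ) (z : Fin j ⊕ Fin j) (q : (Fin (k + 1) ⊕ Fin k) ⊕ (Fin j ⊕ Fin j)) :
    coreTable k j (Sum.inr z) q = if q = Sum.inr z then 1 else 0 := by
  simp [coreTable]

omit [Fintype α] in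
/-- **off-diagonal support**: a nonzero off-diagonal entry `swapTable e a q` has its row `a` in `C ∖ A` (a Y-element). -/
theorem swapTable_offdiag {k j : ℕ} (A C : Finset α) (e : (Fin (k + 1) ⊕ Fin k) ⊕ (Fin j ⊕ Fin j) ≃ α)
    (m1 : ∀ b, e (Sum.inl (Sum.inl b)) ∈ C \ A) {a q : α} (h : swapTable e a q ≠ 0) (hne : q ≠ a) : a ∈ C \ A := by
  unfold swapTable at h
  have hqa : e.symm q ≠ e.symm a := fun h' => hne (e.symm.injective h')
  rcases hx : e.symm a with (b | i) | z
  · have : a = e (Sum.inl (Sum.inl b)) := by rw [← hx, Equiv.apply_symm_apply]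
    rw [this]; exact m1 b
  · exfalso; apply h
    rw [hx, coreTable_inr_row, if_neg (hx ▸ hqa)]
  · exfalso; apply h
    rw [hx, coreTable_inert_row, if_neg (hx ▸ hqa)]

/-- ★ **The first-shell certificate with a prescribed transport** (g16's `exists_table_firstShell_all`, table exposed): for
`|C ∖ A| = k + 1`, `|A ∖ C| = k ≥ 1`, `|A ∩ C| = |(A ∪ C)ᶜ| = j` and ANY four-part equivalence `e`, every injective row family in
`{|S| ≤ k + j, S ≠ A} ∪ {C}` with columns covering the points `|J| ≤ k + j` has nonzero determinant for the table `swapTable e`. -/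
theorem swapTable_det_ne_zero {k j : ℕ} (hk : 1 ≤ k) (A C : Finset α)
    (e : (Fin (k + 1) ⊕ Fin k) ⊕ (Fin j ⊕ Fin j) ≃ α)
    (m1 : ∀ b, e (Sum.inl (Sum.inl b)) ∈ C \ A) (m2 : ∀ i, e (Sum.inl (Sum.inr i)) ∈ A \ C)
    (m3 : ∀ z, e (Sum.inr (Sum.inl z)) ∈ A ∩ C) (m4 : ∀ w, e (Sum.inr (Sum.inr w)) ∈ (A ∪ C)ᶜ)
    {r : ℕ} (v cols : Fin r → Finset α) (hv : Function.Injective v)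
    (hV : ∀ i, ((v i).card ≤ k + j ∧ v i ≠ A) ∨ v i = C)
    (hcols : ∀ J : Finset α, J.card ≤ k + j → ∃ kk, cols kk = J) :
    (mat (swapTable e) v cols).det ≠ 0 := by
  classical
  let Z : Finset (Fin j ⊕ Fin j) := (Finset.univ : Finset (Fin j)).image Sum.inl
  have hZ : Z.card = j := by
    simp only [Z]; rw [Finset.card_image_of_injective _ Sum.inl_injective, Finset.card_univ, Fintype.card_fin]
  let rowS : Fin r → Finset ((Fin (k + 1) ⊕ Fin k) ⊕ (Fin j ⊕ Fin j)) := fun i => (v i).map e.symm.toEmbedding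
  let colJ : Fin r → Finset ((Fin (k + 1) ⊕ Fin k) ⊕ (Fin j ⊕ Fin j)) := fun kk => (cols kk).map e.symm.toEmbedding
  have hmem : ∀ x, (e x ∈ A ↔ x ∈ ((Finset.univ : Finset (Fin k)).image Sum.inr).disjSum Z) ∧
      (e x ∈ C ↔ x ∈ ((Finset.univ : Finset (Fin (k + 1))).image Sum.inl).disjSum Z) := by
    intro x
    rcases x with (b | i) | (z | w')
    · have h := m1 b; rw [Finset.mem_sdiff] at h
      simp [Z, h.1, h.2]
    · have h := m2 i; rw [Finset.mem_sdiff] at h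
      simp [Z, h.1, h.2]
    · have h := m3 z; rw [Finset.mem_inter] at h
      simp [Z, h.1, h.2]
    · have h := m4 w'; rw [Finset.mem_compl, Finset.mem_union, not_or] at h
      simp [Z, h.1, h.2]
  have hmapA : A.map e.symm.toEmbedding = ((Finset.univ : Finset (Fin k)).image Sum.inr).disjSum Z := by
    ext x; rw [Finset.mem_map_equiv, Equiv.symm_symm]; exact (hmem x).1
  have hmapC : C.map e.symm.toEmbedding = ((Finset.univ : Finset (Fin (k + 1))).image Sum.inl).disjSum Z := by
    ext x; rw [Finset.mem_map_equiv, Equiv.symm_symm]; exact (hmem x).2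
  have hinj : Function.Injective rowS := fun i i' hij => hv (Finset.map_injective _ hij)
  have hrow : ∀ i, ((rowS i).card ≤ k + Z.card ∧ rowS i ≠ ((Finset.univ : Finset (Fin k)).image Sum.inr).disjSum Z) ∨
      rowS i = ((Finset.univ : Finset (Fin (k + 1))).image Sum.inl).disjSum Z := by
    intro i
    rcases hV i with ⟨hc, hne⟩ | h
    · left
      refine ⟨by simp only [rowS, Finset.card_map, hZ]; omega, fun h => hne ?_⟩
      rw [← hmapA] at h
      exact Finset.map_injective _ h
    · right; simp only [rowS, h, hmapC]
  have hcol : ∀ J : Finset ((Fin (k + 1) ⊕ Fin k) ⊕ (Fin j ⊕ Fin j)), J.card ≤ k + Z.card → ∃ kk, colJ kk = J := by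
    intro J hJ
    obtain ⟨kk, hkk⟩ := hcols (J.map e.toEmbedding) (by rw [Finset.card_map]; omega)
    refine ⟨kk, ?_⟩
    simp only [colJ, hkk, Finset.map_map]
    convert Finset.map_refl (s := J)
    ext x; simp
  have hdet := det_ne_zero_of_dual_inert (pw k 1) (ppot k) (pw_ne_zero k 1) (pw_self k 1) k
    ((Finset.univ : Finset (Fin k)).image Sum.inr) ((Finset.univ : Finset (Fin (k + 1))).image Sum.inl) (zk k 1)
    (fun R hR => zk_card_ne (by omega)) (fun S hS hX => lambda_row_eq_zero S hS hX) (lambda_Y_ne_zero' hk one_ne_zero)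
    Z (coreTable k j) (fun _ _ => rfl) (fun _ _ => rfl) (fun _ _ => rfl) rowS colJ hinj hrow hcol
  convert hdet using 2
  ext i kk
  simp only [mat, Matrix.of_apply, rowS, colJ, Finset.prod_map, Finset.sum_map]
  rfl

omit [Fintype α] in
/-- the second-shell row set has the cardinality of the ball. -/
theorem card_secondShell_rows (Ball : Finset (Finset α)) {A₁ A₂ C₁ C₂ : Finset α}
    (hA₁ : A₁ ∈ Ball) (hA₂ : A₂ ∈ Ball) (hC₁ : C₁ ∉ Ball) (hC₂ : C₂ ∉ Ball) (hA : A₁ ≠ A₂) (hC : C₁ ≠ C₂) :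
    (insert C₁ (insert C₂ ((Ball.erase A₁).erase A₂))).card = Ball.card := by
  have h2 : A₂ ∈ Ball.erase A₁ := Finset.mem_erase.2 ⟨hA.symm, hA₂⟩
  have hC₂' : C₂ ∉ (Ball.erase A₁).erase A₂ := fun h => hC₂ (Finset.mem_of_mem_erase (Finset.mem_of_mem_erase h))
  have hC₁' : C₁ ∉ insert C₂ ((Ball.erase A₁).erase A₂) := by
    rw [Finset.mem_insert, not_or]
    exact ⟨hC, fun h => hC₁ (Finset.mem_of_mem_erase (Finset.mem_of_mem_erase h))⟩
  rw [Finset.card_insert_of_notMem hC₁', Finset.card_insert_of_notMem hC₂', Finset.card_erase_of_mem h2,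
    Finset.card_erase_of_mem hA₁]
  have : 2 ≤ Ball.card := by
    have : ({A₁, A₂} : Finset (Finset α)) ⊆ Ball := by
      intro x hx; rcases Finset.mem_insert.1 hx with rfl | hx
      · exact hA₁
      · rw [Finset.mem_singleton.1 hx]; exact hA₂
    have := Finset.card_le_card this; rw [Finset.card_pair hA] at this; exact this
  omega

/-- ★ **covering bookkeeping**: if `u : Fin r → Finset α` is injective with values in a set `𝒰` of the ball's cardinality and
the columns `cols : Fin r → Finset α` run through every point of the ball, then `u` hits every member of `𝒰` and every column is
a point of the ball. -/
theorem rows_cover (t : ℕ) (𝒰 : Finset (Finset α))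
    (h𝒰 : 𝒰.card = (Finset.univ.filter fun S : Finset α => S.card ≤ t).card)
    {r : ℕ} (u cols : Fin r → Finset α) (hu : Function.Injective u) (hU : ∀ i, u i ∈ 𝒰)
    (hcols : ∀ J : Finset α, J.card ≤ t → ∃ kk, cols kk = J) :
    (∀ S ∈ 𝒰, ∃ i, u i = S) ∧ (∀ kk, (cols kk).card ≤ t) := by
  classical
  set Ball := Finset.univ.filter fun S : Finset α => S.card ≤ t with hBall
  have hBsub : Ball ⊆ Finset.univ.image cols := by
    intro J hJ
    obtain ⟨kk, hkk⟩ := hcols J (Finset.mem_filter.1 hJ).2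
    exact Finset.mem_image.2 ⟨kk, Finset.mem_univ _, hkk⟩
  have h1 : Ball.card ≤ r := by
    refine (Finset.card_le_card hBsub).trans ?_
    exact Finset.card_image_le.trans (by rw [Finset.card_univ, Fintype.card_fin])
  have hUsub : Finset.univ.image u ⊆ 𝒰 := by
    intro S hS
    obtain ⟨i, -, rfl⟩ := Finset.mem_image.1 hS
    exact hU i
  have h2 : r = (Finset.univ.image u).card := by
    rw [Finset.card_image_of_injective _ hu, Finset.card_univ, Fintype.card_fin]
  have h3 : (Finset.univ.image u).card ≤ 𝒰.card := Finset.card_le_card hUsub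
  have hEqU : Finset.univ.image u = 𝒰 := Finset.eq_of_subset_of_card_le hUsub (by omega)
  have hEqB : Ball = Finset.univ.image cols :=
    Finset.eq_of_subset_of_card_le hBsub (Finset.card_image_le.trans (by rw [Finset.card_univ, Fintype.card_fin]; omega))
  constructor
  · intro S hS
    rw [← hEqU] at hS
    obtain ⟨i, -, hi⟩ := Finset.mem_image.1 hS
    exact ⟨i, hi⟩
  · intro kk
    have : cols kk ∈ Ball := by rw [hEqB]; exact Finset.mem_image.2 ⟨kk, Finset.mem_univ _, rfl⟩
    exact (Finset.mem_filter.1 this).2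

omit [Fintype α] in
/-- updating an injective family at one index with a fresh value keeps it injective. -/
theorem update_injective {β : Type} [DecidableEq β] {r : ℕ} (f : Fin r → β) (hf : Function.Injective f) (i : Fin r) (c : β)
    (hc : ∀ i', f i' ≠ c) : Function.Injective (Function.update f i c) := by
  intro x y h
  by_cases hx : x = i
  · by_cases hy : y = i
    · rw [hx, hy]
    · rw [hx, Function.update_self, Function.update_of_ne hy] at h
      exact absurd h.symm (hc y)
  · by_cases hy : y = i
    · rw [hy, Function.update_self, Function.update_of_ne hx] at h
      exact absurd h (hc x)
    · rw [Function.update_of_ne hx, Function.update_of_ne hy] at h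
      exact hf h

/-! ## ★★ The cell -/

/-- ★★ **SECOND SHELL OF HALF-BALL, IMMOBILE-TOKEN CLASSES, EVERY `t`.**  `|A₁| = |A₂| = t`, `|C₁| = |C₂| = t + 1` in
`Fin (2t+1)`, `A₁ ⊄ C₁`, `A₂ ⊄ C₂`, `A₁ ≠ A₂`, `C₁ ≠ C₂`, and some `z ∈ A₂ ∩ C₂` lies outside `A₁ ∪ C₁`.  Then every injective row
family ranging in `B_t ∖ {A₁, A₂} ∪ {C₁, C₂}` whose columns cover `B_t` is served by a table. -/
theorem exists_table_secondShell_CT (t : ℕ) (A₁ A₂ C₁ C₂ : Finset (Fin (2 * t + 1)))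
    (hA₁ : A₁.card = t) (hA₂ : A₂.card = t) (hC₁ : C₁.card = t + 1) (hC₂ : C₂.card = t + 1)
    (h₁ : ¬ A₁ ⊆ C₁) (h₂ : ¬ A₂ ⊆ C₂) (hA : A₁ ≠ A₂) (hC : C₁ ≠ C₂)
    (hz : ∃ z, z ∈ A₂ ∧ z ∈ C₂ ∧ z ∉ A₁ ∧ z ∉ C₁)
    {r : ℕ} (u cols : Fin r → Finset (Fin (2 * t + 1))) (hu : Function.Injective u)
    (hU : ∀ i, ((u i).card ≤ t ∧ u i ≠ A₁ ∧ u i ≠ A₂) ∨ u i = C₁ ∨ u i = C₂)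
    (hcols : ∀ J : Finset (Fin (2 * t + 1)), J.card ≤ t → ∃ kk, cols kk = J) :
    ∃ tx : Option (Fin (2 * t + 1)) → Fin (2 * t + 1) → ℂ,
      (Matrix.of fun i kk : Fin r => ∏ a ∈ u i, (tx none a + ∑ q ∈ cols kk, tx (some q) a)).det ≠ 0 := by
  classical
  obtain ⟨z, hzA₂, hzC₂, hzA₁, hzC₁⟩ := hz
  -- sizes of the two swaps
  have size : ∀ (A C : Finset (Fin (2 * t + 1))), A.card = t → C.card = t + 1 → ¬ A ⊆ C →
      ∃ k j, 1 ≤ k ∧ k + j = t ∧ (C \ A).card = k + 1 ∧ (A \ C).card = k ∧ (A ∩ C).card = j ∧ (A ∪ C)ᶜ.card = j := by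
    intro A C hAc hCc hAC
    refine ⟨t - (A ∩ C).card, (A ∩ C).card, ?_, ?_, ?_, ?_, rfl, ?_⟩
    · have hlt : (A ∩ C).card < A.card := by
        refine Finset.card_lt_card ⟨Finset.inter_subset_left, fun h => hAC ?_⟩
        exact fun x hx => (Finset.mem_inter.1 (h hx)).2
      omega
    · have := Finset.card_le_card (Finset.inter_subset_left : A ∩ C ⊆ A); omega
    · have := Finset.card_sdiff_add_card_inter C A; rw [Finset.inter_comm] at this
      have h' := Finset.card_le_card (Finset.inter_subset_left : A ∩ C ⊆ A); omega
    · have := Finset.card_sdiff_add_card_inter A C; omega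
    · have hU := Finset.card_union_add_card_inter A C; rw [Finset.card_compl, Fintype.card_fin]
      have h' := Finset.card_le_card (Finset.inter_subset_left : A ∩ C ⊆ A); omega
  obtain ⟨k₁, j₁, hk₁, hkj₁, a1, a2, a3, a4⟩ := size A₁ C₁ hA₁ hC₁ h₁
  obtain ⟨k₂, j₂, hk₂, hkj₂, b1, b2, b3, b4⟩ := size A₂ C₂ hA₂ hC₂ h₂
  obtain ⟨e₁, m1, m2, m3, m4⟩ := exists_equiv_four A₁ C₁ a1 a2 a3 a4
  obtain ⟨e₂, n1, n2, n3, n4⟩ := exists_equiv_four A₂ C₂ b1 b2 b3 b4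
  -- the two tables (off-diagonal parts)
  let N₁ : Fin (2 * t + 1) → Fin (2 * t + 1) → ℂ := fun a q => swapTable e₁ a q - if q = a then 1 else 0
  let N₂ : Fin (2 * t + 1) → Fin (2 * t + 1) → ℂ := fun a q => swapTable e₂ a q - if q = a then 1 else 0
  have hT10 : tab2 N₁ N₂ ![1, 0] = swapTable e₁ := by
    funext a q; simp [tab2, N₁]
  have hT01 : tab2 N₁ N₂ ![0, 1] = swapTable e₂ := by
    funext a q; simp [tab2, N₂]
  -- bookkeeping: `u` hits `C₁, C₂` and every ball set other than `A₁, A₂`; columns are points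
  set Ball := Finset.univ.filter fun S : Finset (Fin (2 * t + 1)) => S.card ≤ t with hBall
  set 𝒰 := insert C₁ (insert C₂ ((Ball.erase A₁).erase A₂)) with h𝒰
  have hBA₁ : A₁ ∈ Ball := Finset.mem_filter.2 ⟨Finset.mem_univ _, by omega⟩
  have hBA₂ : A₂ ∈ Ball := Finset.mem_filter.2 ⟨Finset.mem_univ _, by omega⟩
  have hBC₁ : C₁ ∉ Ball := fun h => by have := (Finset.mem_filter.1 h).2; omega
  have hBC₂ : C₂ ∉ Ball := fun h => by have := (Finset.mem_filter.1 h).2; omega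
  have h𝒰card : 𝒰.card = Ball.card := card_secondShell_rows Ball hBA₁ hBA₂ hBC₁ hBC₂ hA hC
  have hUmem : ∀ i, u i ∈ 𝒰 := by
    intro i
    rcases hU i with ⟨hc, hne₁, hne₂⟩ | h | h
    · refine Finset.mem_insert_of_mem (Finset.mem_insert_of_mem ?_)
      exact Finset.mem_erase.2 ⟨hne₂, Finset.mem_erase.2 ⟨hne₁, Finset.mem_filter.2 ⟨Finset.mem_univ _, hc⟩⟩⟩
    · rw [h]; exact Finset.mem_insert_self _ _
    · rw [h]; exact Finset.mem_insert_of_mem (Finset.mem_insert_self _ _)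
  obtain ⟨hhit, hcolcard⟩ := rows_cover t 𝒰 h𝒰card u cols hu hUmem hcols
  obtain ⟨i₁, hi₁⟩ := hhit C₁ (Finset.mem_insert_self _ _)
  obtain ⟨i₂, hi₂⟩ := hhit C₂ (Finset.mem_insert_of_mem (Finset.mem_insert_self _ _))
  have hne : i₁ ≠ i₂ := fun h => hC (by rw [← hi₁, ← hi₂, h])
  have hball : ∀ R : Finset (Fin (2 * t + 1)), R.card ≤ t → R ≠ A₁ → R ≠ A₂ → ∃ i, i ≠ i₁ ∧ i ≠ i₂ ∧ u i = R := by
    intro R hR hR₁ hR₂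
    obtain ⟨i, hi⟩ := hhit R (Finset.mem_insert_of_mem (Finset.mem_insert_of_mem
      (Finset.mem_erase.2 ⟨hR₂, Finset.mem_erase.2 ⟨hR₁, Finset.mem_filter.2 ⟨Finset.mem_univ _, hR⟩⟩⟩)))
    refine ⟨i, ?_, ?_, hi⟩ <;> (rintro rfl; first | (rw [hi₁] at hi) | (rw [hi₂] at hi)) <;> (rw [← hi] at hR; omega)
  -- the base enumeration `b` (the ball) and `u` as its double update
  let b : Fin r → Finset (Fin (2 * t + 1)) := Function.update (Function.update u i₁ A₁) i₂ A₂
  have hb₁ : b i₁ = A₁ := by simp only [b, Function.update_of_ne hne, Function.update_self]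
  have hb₂ : b i₂ = A₂ := by simp only [b, Function.update_self]
  have hb : ∀ i, i ≠ i₁ → i ≠ i₂ → b i = u i := fun i h1 h2 => by simp only [b, Function.update_of_ne h2, Function.update_of_ne h1]
  have hub : Function.update (Function.update b i₁ C₁) i₂ C₂ = u := by
    funext i
    by_cases h2 : i = i₂
    · subst h2; rw [Function.update_self, hi₂]
    · rw [Function.update_of_ne h2]
      by_cases h1 : i = i₁
      · subst h1; rw [Function.update_self, hi₁]
      · rw [Function.update_of_ne h1, hb i h1 h2]
  have hbval : ∀ i, i ≠ i₁ → i ≠ i₂ → (b i).card ≤ t ∧ b i ≠ A₁ ∧ b i ≠ A₂ := by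
    intro i h1 h2
    rw [hb i h1 h2]
    rcases hU i with h | h | h
    · exact h
    · exact absurd (hi₁ ▸ h) (fun hh => h1 (hu hh))
    · exact absurd (hi₂ ▸ h) (fun hh => h2 (hu hh))
  -- injectivity of the updated enumerations
  have hAu : ∀ i, u i ≠ A₁ ∧ u i ≠ A₂ := by
    intro i
    rcases hU i with ⟨-, hne₁, hne₂⟩ | h' | h'
    · exact ⟨hne₁, hne₂⟩
    · rw [h']; constructor <;> (intro h; rw [h] at hC₁; omega)
    · rw [h']; constructor <;> (intro h; rw [h] at hC₂; omega)
  have hbinj : Function.Injective b := by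
    refine update_injective _ (update_injective u hu i₁ A₁ fun i => (hAu i).1) i₂ A₂ fun i' => ?_
    by_cases h : i' = i₁
    · rw [h, Function.update_self]; exact hA
    · rw [Function.update_of_ne h]; exact (hAu i').2
  have hC₁b : ∀ i, b i ≠ C₁ := by
    intro i h
    by_cases h1 : i = i₁
    · rw [h1, hb₁] at h; rw [h] at hA₁; omega
    by_cases h2 : i = i₂
    · rw [h2, hb₂] at h; rw [h] at hA₂; omega
    · rw [hb i h1 h2, ← hi₁] at h; exact h1 (hu h)
  have hC₂b : ∀ i, b i ≠ C₂ := by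
    intro i h
    by_cases h1 : i = i₁
    · rw [h1, hb₁] at h; rw [h] at hA₁; omega
    by_cases h2 : i = i₂
    · rw [h2, hb₂] at h; rw [h] at hA₂; omega
    · rw [hb i h1 h2, ← hi₂] at h; exact h2 (hu h)
  -- first-shell certificate for swap 1 on the rows `b[i₁ ↦ C₁]`
  have hF1 : (mat (tab2 N₁ N₂ ![1, 0]) (Function.update b i₁ C₁) cols).det ≠ 0 := by
    rw [hT10]
    refine swapTable_det_ne_zero hk₁ A₁ C₁ e₁ m1 m2 m3 m4 _ cols (update_injective b hbinj i₁ C₁ hC₁b) ?_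
      (by rw [hkj₁]; exact hcols)
    intro i
    by_cases hi : i = i₁
    · right; rw [hi, Function.update_self]
    · left
      rw [Function.update_of_ne hi]
      by_cases h2 : i = i₂
      · rw [h2, hb₂]; exact ⟨by omega, Ne.symm hA⟩
      · have := hbval i hi h2; exact ⟨by rw [hkj₁]; exact this.1, this.2.1⟩
  -- first-shell certificate for swap 2 on the rows `b[i₂ ↦ C₂]`
  have hF2 : (mat (tab2 N₁ N₂ ![0, 1]) (Function.update b i₂ C₂) cols).det ≠ 0 := by
    rw [hT01]
    refine swapTable_det_ne_zero hk₂ A₂ C₂ e₂ n1 n2 n3 n4 _ cols (update_injective b hbinj i₂ C₂ hC₂b) ?_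
      (by rw [hkj₂]; exact hcols)
    intro i
    by_cases hi : i = i₂
    · right; rw [hi, Function.update_self]
    · left
      rw [Function.update_of_ne hi]
      by_cases h1 : i = i₁
      · rw [h1, hb₁]; exact ⟨by omega, hA⟩
      · have := hbval i h1 hi; exact ⟨by rw [hkj₂]; exact this.1, this.2.2⟩
  -- the trapped token: `{z}` is forward-closed for every parameter, and the cross minor `D_{B − A₁ + C₂}` vanishes
  have hZ : ∀ ε, (mat (tab2 N₁ N₂ ε) (Function.update b i₁ C₂) cols).det = 0 := by
    intro ε
    have hrow₁ : ∀ q, q ≠ z → swapTable e₁ z q = 0 := by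
      intro q hq; by_contra h
      have := swapTable_offdiag A₁ C₁ e₁ m1 h hq
      rw [Finset.mem_sdiff] at this; exact hzC₁ this.1
    have hrow₂ : ∀ q, q ≠ z → swapTable e₂ z q = 0 := by
      intro q hq; by_contra h
      have := swapTable_offdiag A₂ C₂ e₂ n1 h hq
      rw [Finset.mem_sdiff] at this; exact this.2 hzA₂
    refine det_eq_zero_of_trapped (tab2 N₁ N₂ ε) {z} ?_ t (Function.update b i₁ C₂) cols hcolcard i₁ ?_ ?_
    · intro a ha q hq
      rw [Finset.mem_singleton] at ha; subst ha
      rw [Finset.mem_singleton]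
      by_contra hqa
      apply hq
      simp only [tab2, N₁, N₂, hrow₁ q hqa, hrow₂ q hqa, if_neg hqa]
      ring
    · rw [Function.update_self]
      exact ⟨z, Finset.mem_inter.2 ⟨hzC₂, Finset.mem_singleton_self z⟩⟩
    · intro R hR hRz
      obtain ⟨x, hx⟩ := hRz
      rw [Finset.mem_inter, Finset.mem_singleton] at hx
      obtain ⟨hxR, rfl⟩ := hx
      have hR₁ : R ≠ A₁ := fun h => hzA₁ (h ▸ hxR)
      by_cases hR₂ : R = A₂
      · refine ⟨i₂, Ne.symm hne, ?_⟩
        rw [Function.update_of_ne (Ne.symm hne), hb₂, hR₂]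
      · obtain ⟨i, hi1, hi2, hi⟩ := hball R hR hR₁ hR₂
        exact ⟨i, hi1, by rw [Function.update_of_ne hi1, hb i hi1 hi2, hi]⟩
  -- compose
  obtain ⟨tx, htx⟩ := exists_table_of_cross_zero N₁ N₂ b cols hne C₁ C₂ hF1 hF2 (Or.inl hZ)
  exact ⟨tx, by rw [hub] at htx; exact htx⟩

end SecondShell

end

end Summit.ValiantsHypothesis.ValiantsHypothesis.Theorems.BarrierLever.HiddenStates
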